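import Summits.CriticalPhenomena.PercolationContinuityZ3.Theorems.Transplant.FKConnectivityAllQAntipodalX2Words
import HarnessLib

/-!
# Connectivity correlation inequalities for `φ_{w,q}` — the TYPE-WORD MODEL of `X2`, file 2: row algebra under a window swap
# and the validity of BALANCED windows (memo g13 Lemma 3.2)

Helper file (`--supports stmt-CriticalPhenomena-4575`), FK sub-lane `prim-bschramm-fk-2` (gen 13); builds on p205010 (kernel
theorem, internal audit signed; external expert review pending).  Pure finite combinatorics on the type-word model of
`…AntipodalX2Words` (memo `bschramm/FROM-fk-2-g13-WORD-HALL.md` §3.1–3.2).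

For a type word that is ground outside a window, `x = E^a ++ mid ++ E^b`, row `A` is `walls ++ rowA mid ++ walls` and row `B` is
`particles ++ rowB mid ++ particles` (`rowA_decomp`, `rowA_ground_allW`, …); the window swap replaces `mid` by `mid.map swap`,
which EXCHANGES the two middle rows (`rowA_map_swap`).  Every quantity entering the loser test and the level sees the middle
rows only through `headP`, `lastP`, `runsP` (`headP_W_mid_W`, `runsP_P_mid_P`, …).  Hence
**`balanced_window_valid`** (Lemma 3.2): if the middle rows are nonempty and BALANCED (`headP μ_A = headP μ_B`,
`lastP μ_A = lastP μ_B`), the swapped word is again a loser, of the same level.  This is the validity half of Theorem A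
(the rule `ruleN` produces balanced windows — sibling files).
[cite: Grimmett2006, §3.9 (p. 63)]
-/

namespace Summit.CriticalPhenomena.PercolationContinuityZ3.Theorems

namespace FK

namespace X2Word

/-! ### Row algebra under a window swap (memo g13 §3.1) and the validity of balanced windows (Lemma 3.2) -/

section RowAlgebra

/-- `headP` of a concatenation. [folklore] -/
theorem headP_append (l₁ l₂ : List Kind) : headP (l₁ ++ l₂) = if l₁ = [] then headP l₂ else headP l₁ := by
  cases l₁ <;> simp [headP]

/-- `lastP` of a concatenation. [folklore] -/
theorem lastP_append (l₁ l₂ : List Kind) : lastP (l₁ ++ l₂) = if l₂ = [] then lastP l₁ else lastP l₂ := by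
  by_cases h : l₂ = []
  · simp [h]
  · obtain ⟨a, ha⟩ : ∃ a, l₂.getLast? = some a := by
      cases hl : l₂.getLast? with
      | none => exact absurd (List.getLast?_eq_none_iff.mp hl) h
      | some a => exact ⟨a, rfl⟩
    simp [lastP, List.getLast?_append, ha, h]

/-- A word all of whose letters are walls does not start with a particle. [folklore] -/
theorem headP_of_allW {l : List Kind} (h : ∀ a ∈ l, a = .W) : headP l = false := by
  cases l with
  | nil => rfl
  | cons a l => have := h a (by simp); subst this; rfl

/-- A word all of whose letters are walls does not end with a particle. [folklore] -/
theorem lastP_of_allW {l : List Kind} (h : ∀ a ∈ l, a = .W) : lastP l = false := by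
  unfold lastP
  cases hl : l.getLast? with
  | none => rfl
  | some a => have := h a (List.mem_of_getLast? hl); subst this; rfl

/-- A nonempty word all of whose letters are particles starts with a particle. [folklore] -/
theorem headP_of_allP {l : List Kind} (h : ∀ a ∈ l, a = .P) (hne : l ≠ []) : headP l = true := by
  cases l with
  | nil => exact absurd rfl hne
  | cons a l => have := h a (by simp); subst this; rfl

/-- A nonempty word all of whose letters are particles ends with a particle. [folklore] -/
theorem lastP_of_allP {l : List Kind} (h : ∀ a ∈ l, a = .P) (hne : l ≠ []) : lastP l = true := by
  unfold lastP
  cases hl : l.getLast? with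
  | none => exact absurd (List.getLast?_eq_none_iff.mp hl) hne
  | some a => have := h a (List.mem_of_getLast? hl); subst this; rfl

/-- The 'previous letter was a particle' flag after reading `l` from the flag `b`. [folklore] -/
def lastFlag (b : Bool) (l : List Kind) : Bool := if l = [] then b else lastP l

/-- `lastP` of a `cons`. [folklore] -/
theorem lastP_cons (a : Kind) (l : List Kind) : lastP (a :: l) = if l = [] then decide (a = .P) else lastP l := by
  cases l with
  | nil => cases a <;> rfl
  | cons b l => simp [lastP, List.getLast?_cons_cons]

/-- The flag after a `cons`. [folklore] -/
theorem lastFlag_cons (b : Bool) (a : Kind) (l : List Kind) : lastFlag b (a :: l) = lastFlag (decide (a = .P)) l := by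
  simp only [lastFlag, List.cons_ne_nil, if_false, lastP_cons]

/-- The flag after a concatenation. [folklore] -/
theorem lastFlag_append (b : Bool) (l₁ l₂ : List Kind) : lastFlag b (l₁ ++ l₂) = lastFlag (lastFlag b l₁) l₂ := by
  induction l₁ generalizing b with
  | nil => simp [lastFlag]
  | cons a l ih => rw [List.cons_append, lastFlag_cons, lastFlag_cons, ih]

/-- The flag after a nonempty word is its last letter. [folklore] -/
theorem lastFlag_of_ne_nil (b : Bool) {l : List Kind} (h : l ≠ []) : lastFlag b l = lastP l := by
  simp [lastFlag, h]

/-- Runs of a concatenation. [folklore] -/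
theorem runsAux_append (b : Bool) (l₁ l₂ : List Kind) :
    runsAux b (l₁ ++ l₂) = runsAux b l₁ + runsAux (lastFlag b l₁) l₂ := by
  induction l₁ generalizing b with
  | nil => simp [runsAux, lastFlag]
  | cons a l ih =>
    rw [List.cons_append, lastFlag_cons]
    cases a with
    | W => simp only [runsAux, ih]; rfl
    | P => simp only [runsAux, ih, Nat.add_assoc]; rfl

/-- A word of walls has no particle run. [folklore] -/
theorem runsAux_of_allW (b : Bool) {l : List Kind} (h : ∀ a ∈ l, a = .W) : runsAux b l = 0 := by
  induction l generalizing b with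
  | nil => rfl
  | cons a l ih =>
    have := h a (by simp); subst this
    simp only [runsAux]
    exact ih _ fun a ha => h a (by simp [ha])

/-- A nonempty word of particles is one run (none if it continues a run). [folklore] -/
theorem runsAux_of_allP (b : Bool) {l : List Kind} (h : ∀ a ∈ l, a = .P) :
    runsAux b l = if l = [] then 0 else (if b then 0 else 1) := by
  induction l generalizing b with
  | nil => rfl
  | cons a l ih =>
    have := h a (by simp); subst this
    have ih' := ih true fun a ha => h a (by simp [ha])
    simp only [runsAux, ih', List.cons_ne_nil, if_false]
    split_ifs <;> simp

/-- Starting inside a run costs the first run if the word starts with a particle. [folklore] -/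
theorem runsAux_true_add (l : List Kind) : runsAux true l + (if headP l then 1 else 0) = runsAux false l := by
  cases l with
  | nil => rfl
  | cons a l => cases a <;> simp [runsAux, headP, Nat.add_comm]

/-- The flag after a word of walls is `false` (if nonempty). [folklore] -/
theorem lastFlag_of_allW (b : Bool) {l : List Kind} (h : ∀ a ∈ l, a = .W) : lastFlag b l = if l = [] then b else false := by
  unfold lastFlag; split_ifs with hl
  · rfl
  · exact lastP_of_allW h

/-- The flag after a word of particles is `true` (if nonempty). [folklore] -/
theorem lastFlag_of_allP (b : Bool) {l : List Kind} (h : ∀ a ∈ l, a = .P) : lastFlag b l = if l = [] then b else true := by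
  unfold lastFlag; split_ifs with hl
  · rfl
  · exact lastP_of_allP h hl

/-- MASTER FORMULA FOR RUNS, row `A` shape: walls around a middle word do not change its number of particle runs. [folklore] -/
theorem runsP_W_mid_W {pa sa : List Kind} (hpa : ∀ a ∈ pa, a = .W) (hsa : ∀ a ∈ sa, a = .W) (μ : List Kind) :
    runsP (pa ++ μ ++ sa) = runsP μ := by
  simp only [runsP, runsAux_append, runsAux_of_allW _ hpa, runsAux_of_allW _ hsa, lastFlag_of_allW _ hpa, Nat.zero_add,
    Nat.add_zero]
  split_ifs <;> rfl

/-- MASTER FORMULA FOR RUNS, row `B` shape: particles around a nonempty middle word `μ` add one run on each side where `μ` does not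
already show a particle. [folklore] -/
theorem runsP_P_mid_P {pb sb : List Kind} (hpb : ∀ a ∈ pb, a = .P) (hsb : ∀ a ∈ sb, a = .P) {μ : List Kind} (hμ : μ ≠ []) :
    runsP (pb ++ μ ++ sb) =
      runsP μ + (if pb ≠ [] ∧ headP μ = false then 1 else 0) + (if sb ≠ [] ∧ lastP μ = false then 1 else 0) := by
  have key := runsAux_true_add μ
  have h1 : runsP (pb ++ μ ++ sb) =
      runsAux false pb + runsAux (lastFlag false pb) μ + runsAux (lastP μ) sb := by
    simp only [runsP, runsAux_append, lastFlag_append, lastFlag_of_ne_nil _ hμ]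
  rw [h1, runsAux_of_allP _ hpb, runsAux_of_allP _ hsb, lastFlag_of_allP _ hpb]
  unfold runsP
  rcases Bool.eq_false_or_eq_true (headP μ) with hh | hh <;> rcases Bool.eq_false_or_eq_true (lastP μ) with hl | hl <;>
    by_cases hp : pb = [] <;> by_cases hs : sb = [] <;> simp [hp, hs, hh, hl] at key ⊢ <;> omega

/-- `headP` of `walls ++ μ ++ walls'` (μ nonempty). [folklore] -/
theorem headP_W_mid_W {pa : List Kind} (hpa : ∀ a ∈ pa, a = .W) (sa : List Kind) {μ : List Kind} (hμ : μ ≠ []) :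
    headP (pa ++ μ ++ sa) = (decide (pa = []) && headP μ) := by
  rw [List.append_assoc, headP_append]
  by_cases hp : pa = []
  · simp [hp, headP_append, hμ]
  · simp [hp, headP_of_allW hpa]

/-- `lastP` of `walls ++ μ ++ walls'` (μ nonempty). [folklore] -/
theorem lastP_W_mid_W (pa : List Kind) {sa : List Kind} (hsa : ∀ a ∈ sa, a = .W) {μ : List Kind} (hμ : μ ≠ []) :
    lastP (pa ++ μ ++ sa) = (decide (sa = []) && lastP μ) := by
  rw [lastP_append]
  by_cases hs : sa = []
  · simp [hs, lastP_append, hμ]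
  · simp [hs, lastP_of_allW hsa]

/-- `headP` of `particles ++ μ ++ particles'` (μ nonempty). [folklore] -/
theorem headP_P_mid_P {pb : List Kind} (hpb : ∀ a ∈ pb, a = .P) (sb : List Kind) {μ : List Kind} (hμ : μ ≠ []) :
    headP (pb ++ μ ++ sb) = (!decide (pb = []) || headP μ) := by
  rw [List.append_assoc, headP_append]
  by_cases hp : pb = []
  · simp [hp, headP_append, hμ]
  · simp [hp, headP_of_allP hpb hp]

/-- `lastP` of `particles ++ μ ++ particles'` (μ nonempty). [folklore] -/
theorem lastP_P_mid_P (pb : List Kind) {sb : List Kind} (hsb : ∀ a ∈ sb, a = .P) {μ : List Kind} (hμ : μ ≠ []) :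
    lastP (pb ++ μ ++ sb) = (!decide (sb = []) || lastP μ) := by
  rw [lastP_append]
  by_cases hs : sb = []
  · simp [hs, lastP_append, hμ]
  · simp [hs, lastP_of_allP hsb hs]

/-- Row `A` of a ground word consists of walls. [folklore] -/
theorem rowA_ground_allW (k : Kind) (n : ℕ) : ∀ a ∈ rowA k (List.replicate n .E), a = .W := by
  induction n generalizing k with
  | zero => simp
  | succ n ih =>
    intro a ha
    rw [List.replicate_succ, rowA_cons] at ha
    cases k <;> simp [visA] at ha
    · rcases ha with h | h
      · exact h.symm ▸ rfl
      · exact ih _ a h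
    · exact ih _ a ha

/-- Row `B` of a ground word consists of particles. [folklore] -/
theorem rowB_ground_allP (k : Kind) (n : ℕ) : ∀ a ∈ rowB k (List.replicate n .E), a = .P := by
  induction n generalizing k with
  | zero => simp
  | succ n ih =>
    intro a ha
    rw [List.replicate_succ, rowB_cons] at ha
    cases k <;> simp [visB] at ha
    · exact ih _ a ha
    · rcases ha with h | h
      · exact h.symm ▸ rfl
      · exact ih _ a h

/-- A window swap in append form: swapping the middle of `pre ++ mid ++ suf`. [folklore] -/
theorem swapWin_append (pre mid suf : List Ty) (hmid : mid ≠ []) :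
    swapWin pre.length (pre.length + mid.length - 1) (pre ++ mid ++ suf) = pre ++ mid.map Ty.swap ++ suf := by
  apply List.ext_getElem (by simp)
  intro i h₁ h₂
  have hm : 0 < mid.length := List.length_pos_of_ne_nil hmid
  simp only [swapWin, List.getElem_mapIdx, List.append_assoc]
  rcases lt_or_ge i pre.length with hi | hi
  · rw [List.getElem_append_left hi, List.getElem_append_left hi]
    simp [show ¬ (pre.length ≤ i) from not_le.mpr hi]
  · rw [List.getElem_append_right hi, List.getElem_append_right hi]
    rcases lt_or_ge (i - pre.length) mid.length with hj | hj
    · rw [List.getElem_append_left hj, List.getElem_append_left (by simpa using hj)]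
      simp [hi, show i ≤ pre.length + mid.length - 1 by omega]
    · rw [List.getElem_append_right hj, List.getElem_append_right (by simpa using hj)]
      simp [show ¬ (i ≤ pre.length + mid.length - 1) by omega]

/-- Rows of a word that is ground outside a window (memo g13 §3.1): row `A` = walls ++ (row `A` of the middle) ++ walls,
row `B` = particles ++ (row `B` of the middle) ++ particles. [folklore] -/
theorem rowA_decomp (k₀ : Kind) (a : ℕ) (mid : List Ty) (b : ℕ) :
    rowA k₀ (List.replicate a .E ++ mid ++ List.replicate b .E) =
      rowA k₀ (List.replicate a .E) ++ rowA (kindAt k₀ a) mid ++ rowA (kindAt k₀ (a + mid.length)) (List.replicate b .E) := by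
  rw [rowA_append, rowA_append]
  simp [kindAt, Function.iterate_add_apply]

/-- Row `B` analogue of `rowA_decomp`. [folklore] -/
theorem rowB_decomp (k₀ : Kind) (a : ℕ) (mid : List Ty) (b : ℕ) :
    rowB k₀ (List.replicate a .E ++ mid ++ List.replicate b .E) =
      rowB k₀ (List.replicate a .E) ++ rowB (kindAt k₀ a) mid ++ rowB (kindAt k₀ (a + mid.length)) (List.replicate b .E) := by
  rw [rowB_append, rowB_append]
  simp [kindAt, Function.iterate_add_apply]

/-- **Lemma 3.2 (memo g13): BALANCED WINDOWS ARE VALID.**  Let `x = E^a ++ mid ++ E^b` be a loser whose middle rows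
`μ_A = rowA k mid`, `μ_B = rowB k mid` (`k` the kind of block `a`) are nonempty and BALANCED at both ends
(`headP μ_A = headP μ_B`, `lastP μ_A = lastP μ_B`).  Then the window swap `z = E^a ++ mid.map swap ++ E^b` is a loser of the same
level.  Proof: the rows of `z` are those of `x` with `μ_A`, `μ_B` exchanged, and every quantity entering the loser test and the level
sees the middle rows only through `headP`, `lastP` and (symmetrically) `runsP`. [folklore] -/
theorem balanced_window_valid (k₀ : Kind) (a b : ℕ) (mid : List Ty)
    (hA : rowA (kindAt k₀ a) mid ≠ []) (hB : rowB (kindAt k₀ a) mid ≠ [])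
    (hhead : headP (rowA (kindAt k₀ a) mid) = headP (rowB (kindAt k₀ a) mid))
    (hlast : lastP (rowA (kindAt k₀ a) mid) = lastP (rowB (kindAt k₀ a) mid))
    (hx : isLoser k₀ (List.replicate a .E ++ mid ++ List.replicate b .E) = true) :
    isLoser k₀ (List.replicate a .E ++ mid.map Ty.swap ++ List.replicate b .E) = true ∧
      level k₀ (List.replicate a .E ++ mid.map Ty.swap ++ List.replicate b .E) =
        level k₀ (List.replicate a .E ++ mid ++ List.replicate b .E) := by
  have hpa := rowA_ground_allW k₀ a
  have hsa := rowA_ground_allW (kindAt k₀ (a + mid.length)) b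
  have hpb := rowB_ground_allP k₀ a
  have hsb := rowB_ground_allP (kindAt k₀ (a + mid.length)) b
  have hA' : rowA (kindAt k₀ a) (mid.map Ty.swap) ≠ [] := by rwa [rowA_map_swap]
  have hB' : rowB (kindAt k₀ a) (mid.map Ty.swap) ≠ [] := by rwa [rowB_map_swap]
  have hlen : (mid.map Ty.swap).length = mid.length := by simp
  simp only [isLoser, level, rowA_decomp, rowB_decomp, hlen, rowA_map_swap, rowB_map_swap,
    headP_W_mid_W hpa _ hA, headP_W_mid_W hpa _ hB, lastP_W_mid_W _ hsa hA, lastP_W_mid_W _ hsa hB,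
    headP_P_mid_P hpb _ hA, headP_P_mid_P hpb _ hB, lastP_P_mid_P _ hsb hA, lastP_P_mid_P _ hsb hB,
    runsP_W_mid_W hpa hsa, runsP_P_mid_P hpb hsb hA, runsP_P_mid_P hpb hsb hB, hhead, hlast] at hx ⊢
  refine ⟨hx, ?_⟩
  omega

end RowAlgebra

end X2Word

end FK

end Summit.CriticalPhenomena.PercolationContinuityZ3.Theorems
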